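import Mathlib

/-!
# Square-zero normal form (chain w45c, rung SQZ-1: pure linear algebra)

(crux stmt-ResolutionOfSingularities-15640 `WildQuotients.WildQuotientResolution`, line `Sketch`;
rung SQZ of `L/w45c/W45cPlanSignaturesV4.lean` §A, candidate SQZ-1 VERBATIM plus an index-generic
form; [OURS · L1 W4.5c] — NOT a statement of any manuscript.)

A square-zero endomorphism `N` (`N ∘ N = 0`) of a finite-dimensional vector space `V` admits a
basis in «linear-small-blocks position»: there are a basis `b`, a set `D` of indices and a map `f`
with `f(D) ∩ D = ∅`, `N bᵢ = b_{f i}` for `i ∈ D` and `N bᵢ = 0` for `i ∉ D` (Jordan normal form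
for `N² = 0`: all blocks have size `≤ 2`). Construction: `K = ker N ⊇ R = range N`; pick a
complement `W` of `K` and a complement `C` of `R` inside `K`; a basis `(wⱼ)` of `W`, the vectors
`(N wⱼ)` and a basis of `C` together form a basis of `V` (`dim W = dim R` by rank–nullity).

* `exists_basis_of_sq_zero_index` — the statement for any index type `ι` with `card ι = finrank V`;
* `exists_basis_of_sq_zero` — SQZ-1 verbatim (`ι = Fin (finrank V)`).

Used by `…LinearSqZero` (SQZ-2/3/4: every LINEAR `σ` on `k[x₁,…,xₙ]` with `(σ-1)² = 0`, in
particular every linear involution in characteristic `2`, has a resolvable quotient `𝔸ⁿ/σ`).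
-/

-- single-problem summit: the doubled namespace component `ResolutionOfSingularities` is forced
set_option linter.dupNamespace false

noncomputable section

open Module Submodule

namespace Summit.ResolutionOfSingularities.ResolutionOfSingularities.Theorems.WildQuotientResolution.LinearSqZero

variable {k V : Type*} [Field k] [AddCommGroup V] [Module k V]

/-- The range of a square-zero endomorphism lies in its kernel. [folklore] -/
theorem range_le_ker_of_sq_zero (N : V →ₗ[k] V) (hN : N ∘ₗ N = 0) :
    LinearMap.range N ≤ LinearMap.ker N := by
  rintro _ ⟨v, rfl⟩
  rw [LinearMap.mem_ker, ← LinearMap.comp_apply, hN, LinearMap.zero_apply]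

/-- The span of a basis of a submodule `W`, viewed in the ambient space, is `W`. [folklore] -/
theorem span_range_basis_coe {ι : Type*} (W : Submodule k V) (bW : Basis ι k W) :
    span k (Set.range fun j => (bW j : V)) = W := by
  have : (fun j => (bW j : V)) = W.subtype ∘ bW := rfl
  rw [this, Set.range_comp, Submodule.span_image, bW.span_eq, Submodule.map_subtype_top]

/-- A basis of a submodule, viewed in the ambient space, is linearly independent. [folklore] -/
theorem linearIndependent_basis_coe {ι : Type*} (W : Submodule k V) (bW : Basis ι k W) :
    LinearIndependent k fun j => (bW j : V) :=
  bW.linearIndependent.map' W.subtype (Submodule.ker_subtype W)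

/-- **SQZ-1, index-generic form.** A square-zero endomorphism `N` of a finite-dimensional vector
space `V` has, for every index type `ι` with `card ι = finrank V`, a basis `b : ι → V` in
linear-small-blocks position: `N bᵢ = b_{f i}` (`i ∈ D`), `N bᵢ = 0` (`i ∉ D`), `f(D) ∩ D = ∅`.
[folklore; Jordan normal form for `N² = 0`] -/
theorem exists_basis_of_sq_zero_index [FiniteDimensional k V] {ι : Type*} [Fintype ι]
    (N : V →ₗ[k] V) (hN : N ∘ₗ N = 0) (hι : Fintype.card ι = finrank k V) :
    ∃ (b : Basis ι k V) (D : Finset ι) (f : ι → ι),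
      (∀ i ∈ D, f i ∉ D) ∧ (∀ i ∈ D, N (b i) = b (f i)) ∧ (∀ i ∉ D, N (b i) = 0) := by
  classical
  -- the players: `K = ker N ⊇ R = range N`, a complement `W` of `K`, a complement `C` of `R` in `K`
  set K := LinearMap.ker N with hKdef
  set R := LinearMap.range N with hRdef
  have hRK : R ≤ K := range_le_ker_of_sq_zero N hN
  obtain ⟨W, hKW⟩ := Submodule.exists_isCompl K
  obtain ⟨C', hRC'⟩ := Submodule.exists_isCompl R
  set C := C' ⊓ K with hCdef
  have hCK : C ≤ K := inf_le_right
  have hRC : R ⊔ C = K := by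
    rw [hCdef, ← sup_inf_assoc_of_le C' hRK, hRC'.codisjoint.eq_top, top_inf_eq]
  have hRC0 : R ⊓ C = ⊥ := by
    rw [eq_bot_iff, ← hRC'.disjoint.eq_bot]
    exact inf_le_inf_left R inf_le_left
  -- dimensions
  set r := finrank k W with hrdef
  set c := finrank k C with hcdef
  have h1 : finrank k K + r = finrank k V := Submodule.finrank_add_eq_of_isCompl hKW
  have h2 : finrank k R + finrank k K = finrank k V := LinearMap.finrank_range_add_finrank_ker N
  have h3 : finrank k K = finrank k R + c := by
    have h := Submodule.finrank_sup_add_finrank_inf_eq R C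
    rw [hRC, hRC0, finrank_bot, add_zero] at h
    exact h
  have hcard : Fintype.card (Fin r ⊕ (Fin r ⊕ Fin c)) = finrank k V := by
    simp only [Fintype.card_sum, Fintype.card_fin]
    omega
  -- the family
  let bW := Module.finBasis k W
  let bC := Module.finBasis k C
  let v₁ : Fin r → V := fun j => (bW j : V)
  let v₂ : Fin r → V := fun j => N (bW j)
  let v₃ : Fin c → V := fun l => (bC l : V)
  have hsp₁ : span k (Set.range v₁) = W := span_range_basis_coe W bW
  have hsp₃ : span k (Set.range v₃) = C := span_range_basis_coe C bC
  have hsp₂ : span k (Set.range v₂) ≤ R := by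
    rw [Submodule.span_le]
    rintro _ ⟨j, rfl⟩
    exact LinearMap.mem_range_self N _
  have hv₁ : LinearIndependent k v₁ := linearIndependent_basis_coe W bW
  have hv₃ : LinearIndependent k v₃ := linearIndependent_basis_coe C bC
  have hv₂ : LinearIndependent k v₂ := by
    have h := hv₁.map (f := N) (by rw [hsp₁]; exact hKW.symm.disjoint)
    exact h
  have hv₂₃ : LinearIndependent k (Sum.elim v₂ v₃) :=
    hv₂.sum_type hv₃ ((hRC'.disjoint.mono hsp₂ (hsp₃.le.trans inf_le_left)))
  have hsp₂₃ : span k (Set.range (Sum.elim v₂ v₃)) ≤ K := by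
    rw [Set.Sum.elim_range, Submodule.span_union]
    exact sup_le (hsp₂.trans hRK) (hsp₃.le.trans hCK)
  have hv : LinearIndependent k (Sum.elim v₁ (Sum.elim v₂ v₃)) :=
    hv₁.sum_type hv₂₃ (by rw [hsp₁]; exact hKW.symm.disjoint.mono_right hsp₂₃)
  -- the basis, reindexed by `ι`
  let b₀ : Basis (Fin r ⊕ (Fin r ⊕ Fin c)) k V :=
    basisOfLinearIndependentOfCardEqFinrank' _ hv hcard
  have hb₀ : ⇑b₀ = Sum.elim v₁ (Sum.elim v₂ v₃) :=
    coe_basisOfLinearIndependentOfCardEqFinrank' _ hv hcard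
  let e : (Fin r ⊕ (Fin r ⊕ Fin c)) ≃ ι := Fintype.equivOfCardEq (hcard.trans hι.symm)
  let g : Fin r ⊕ (Fin r ⊕ Fin c) → Fin r ⊕ (Fin r ⊕ Fin c) :=
    Sum.elim (fun j => Sum.inr (Sum.inl j)) Sum.inr
  refine ⟨b₀.reindex e, Finset.univ.image fun j => e (Sum.inl j), fun i => e (g (e.symm i)),
    ?_, ?_, ?_⟩
  · -- `f(D) ∩ D = ∅`
    intro i hi hfi
    simp only [Finset.mem_image, Finset.mem_univ, true_and] at hi hfi
    obtain ⟨j, rfl⟩ := hi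
    obtain ⟨j', hj'⟩ := hfi
    rw [e.symm_apply_apply] at hj'
    exact Sum.inl_ne_inr (e.injective hj')
  · -- `N bᵢ = b_{f i}` on `D`
    intro i hi
    simp only [Finset.mem_image, Finset.mem_univ, true_and] at hi
    obtain ⟨j, rfl⟩ := hi
    simp only [Basis.reindex_apply, Equiv.symm_apply_apply, hb₀, g, Sum.elim_inl, Sum.elim_inr, v₁,
      v₂]
  · -- `N bᵢ = 0` off `D`
    intro i hi
    simp only [Finset.mem_image, Finset.mem_univ, true_and, not_exists] at hi
    rw [Basis.reindex_apply, hb₀]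
    have hK : ∀ x, Sum.elim v₁ (Sum.elim v₂ v₃) (Sum.inr x) ∈ K := by
      intro x
      refine hsp₂₃ (Submodule.subset_span ⟨x, ?_⟩)
      simp only [Sum.elim_inr]
    obtain ⟨x, hx⟩ : ∃ x, e.symm i = Sum.inr x := by
      rcases h : e.symm i with j | x
      · exact absurd ((e.apply_symm_apply i).symm.trans (congrArg e h)).symm (hi j)
      · exact ⟨x, rfl⟩
    rw [hx]
    exact hK x

/-- **SQZ-1** (`W45cPlanSignaturesV4.lean` §A, verbatim): a square-zero endomorphism `N` of a
finite-dimensional space has a basis in LSB position: `N bᵢ = b_{f i}` for `i ∈ D`, `N bᵢ = 0` for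
`i ∉ D`, `f(D) ∩ D = ∅`. [folklore; Jordan normal form for `N² = 0`] -/
theorem exists_basis_of_sq_zero (k V : Type) [Field k] [AddCommGroup V] [Module k V]
    [FiniteDimensional k V] (N : V →ₗ[k] V) (hN : N ∘ₗ N = 0) :
    ∃ (b : Module.Basis (Fin (Module.finrank k V)) k V) (D : Finset (Fin (Module.finrank k V)))
      (f : Fin (Module.finrank k V) → Fin (Module.finrank k V)),
      (∀ i ∈ D, f i ∉ D) ∧ (∀ i ∈ D, N (b i) = b (f i)) ∧ (∀ i ∉ D, N (b i) = 0) :=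
  exists_basis_of_sq_zero_index N hN (Fintype.card_fin _)

end Summit.ResolutionOfSingularities.ResolutionOfSingularities.Theorems.WildQuotientResolution.LinearSqZero

end
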